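import Literature.Analysis.FluidPDE.BoundedAnnihilator
import Literature.Analysis.FluidPDE.HarmonicLiouvilleLp
import Literature.Analysis.FluidPDE.MildL3Restart
import Literature.Analysis.UnboundedOperators.HeatKernelStrongContinuityProofs
import HarnessLib

/-!
# KNSS 2009, Lemma 3.1 by duality, II: Liouville for fields with symmetric Jacobian and zero
# divergence; fields with constant caloric extensions are a.e. constant

Second of the self-contained layers replacing the compactness/mollification proof of Lemma 3.1 of
Koch–Nadirashvili–Seregin–Šverák, *Liouville theorems for the Navier–Stokes equations and
applications*, Acta Math. **203** (2009) 83–105 (arXiv:0709.3599v1, §3, p. 7: "`curl u(t₁) -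
curl u(t₂) = 0` … together with `div u = 0` this gives `Δ(u(t₁) - u(t₂)) = 0` and Liouville's theorem
for bounded harmonic functions implies `u(x,t₁) - u(x,t₂) = b`") by statements available for bounded
measurable fields on a finite-dimensional real inner product space `E`:

* `laplacian_inner_const_eq_zero_of_symm_fderiv_of_isDivFree`: a `C²` field `V` with symmetric
  Jacobian (`⟪DV(x)a, c⟫ = ⟪DV(x)c, a⟫`, i.e. `curl V = 0`) and `div V = 0` has harmonic components;
* `apply_eq_apply_of_symm_fderiv_of_isDivFree_of_bounded`: if moreover `V` is bounded it is constant
  (Liouville for bounded harmonic functions, the tree's `HarmonicOnNhd.apply_eq_apply_of_abs_le`);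
* `integral_mul_heatExtension_eq_of_top`, `inner_heatExtension_eq_heatExtension_inner_of_bound`:
  transposition of the Gauss–Weierstrass flow `L^∞ × L¹` and its componentwise action;
* `exists_ae_eq_const_of_heatExtension_eq_const`: a bounded measurable field all of whose caloric
  extensions `e^{rₙΔ}f` along some `rₙ → 0⁺` are constant in space is a.e. constant (pairing with
  tests, strong continuity of the heat flow in `L¹`, and Mathlib's
  `ae_eq_zero_of_integral_contDiff_smul_eq_zero`).

These feed the two-time identity `z(t) = e^{(t-s)Δ} z(s) + β` for bounded weak solutions of the
homogeneous Stokes system (file `KNSSLemma31Homogeneous`) and thence the named fact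
`KNSS2009_weak_driftMild` of `KNSSRegularityDecomposition`.

## References

* [KochNadirashviliSereginSverak2009] H. Koch, N. Nadirashvili, G. Seregin, V. Šverák, *Liouville
  theorems for the Navier–Stokes equations and applications*, Acta Math. 203 (2009), 83–105,
  doi:10.1007/s11511-009-0039-6, arXiv:0709.3599 — Lemma 3.1 and its proof, p. 7.
* E. M. Stein, *Singular Integrals and Differentiability Properties of Functions* (1970), Ch. III
  §2.2 (approximate identities; used through `tendsto_heatExtension_nhdsWithin_zero_holds`).
-/

open MeasureTheory TopologicalSpace Set Function Filter Topology InnerProductSpace Metric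
open scoped RealInnerProductSpace ENNReal NNReal ContDiff Laplacian Convolution

noncomputable section

namespace Literature.Analysis.FluidPDE

variable {E : Type*} [NormedAddCommGroup E] [InnerProductSpace ℝ E] [FiniteDimensional ℝ E]
  [MeasurableSpace E] [BorelSpace E]

/-! ### Symmetric Jacobian and zero divergence force harmonic components -/

section SymmDiv

omit [MeasurableSpace E] [BorelSpace E] in
/-- **A `C²` field with symmetric Jacobian and zero divergence has harmonic components**:
if `⟪DV(x)a, c⟫ = ⟪DV(x)c, a⟫` for all `x, a, c` and `div V = 0`, then `Δ⟪V, a⟫ = 0` for every `a`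
(`Δ⟪V,a⟫ = Σᵢ∂ᵢ⟪DV eᵢ, a⟫ = Σᵢ∂ᵢ⟪DV a, eᵢ⟫ = Σᵢ⟪D²V(eᵢ, a), eᵢ⟫ = Σᵢ⟪D²V(a, eᵢ), eᵢ⟫ = ∂ₐ div V = 0`,
by Schwarz). This is "`curl z = 0`, `div z = 0` ⇒ `Δz = 0`" of KNSS 2009, Lemma 3.1 (arXiv p. 7)
in any dimension. [cite: KochNadirashviliSereginSverak2009, Lemma 3.1, proof (arXiv:0709.3599v1 p. 7)] -/
theorem laplacian_inner_const_eq_zero_of_symm_fderiv_of_isDivFree {V : E → E} (hV : ContDiff ℝ 2 V)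
    (hsymm : ∀ x a c, ⟪fderiv ℝ V x a, c⟫ = ⟪fderiv ℝ V x c, a⟫)
    (hdiv : VectorCalculus.IsDivFree V) (a x : E) :
    (Δ (fun y => ⟪V y, a⟫)) x = 0 := by
  set b := stdOrthonormalBasis ℝ E
  have hVd : ∀ y, DifferentiableAt ℝ V y := fun y => hV.differentiable (by norm_num) y
  have hDV : ContDiff ℝ 1 (fderiv ℝ V) := hV.fderiv_right (m := 1) le_rfl
  have hDVd : ∀ y, DifferentiableAt ℝ (fderiv ℝ V) y := fun y => hDV.differentiable one_ne_zero y
  have hη2 : ContDiff ℝ 2 (fun y => ⟪V y, a⟫) := hV.inner ℝ contDiff_const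
  -- first derivatives of the component, with the symmetry built in
  have h1 : ∀ i, (fun y => fderiv ℝ (fun z => ⟪V z, a⟫) y (b i)) = fun y => ⟪fderiv ℝ V y a, b i⟫ := by
    intro i; funext y
    rw [fderiv_inner_apply ℝ (hVd y) (differentiableAt_const a)]
    simp [hsymm y (b i) a]
  -- second derivatives
  have h2 : ∀ i v, fderiv ℝ (fun y => ⟪fderiv ℝ V y a, b i⟫) x v = ⟪fderiv ℝ (fderiv ℝ V) x v a, b i⟫ := by
    intro i v
    have hd : DifferentiableAt ℝ (fun y => fderiv ℝ V y a) x := (hDVd x).clm_apply (differentiableAt_const a)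
    rw [fderiv_inner_apply ℝ hd (differentiableAt_const _), fderiv_clm_apply (hDVd x) (differentiableAt_const a)]
    simp
  have h2' : ∀ i v, fderiv ℝ (fun y => ⟪fderiv ℝ V y (b i), b i⟫) x v =
      ⟪fderiv ℝ (fderiv ℝ V) x v (b i), b i⟫ := by
    intro i v
    have hd : DifferentiableAt ℝ (fun y => fderiv ℝ V y (b i)) x :=
      (hDVd x).clm_apply (differentiableAt_const _)
    rw [fderiv_inner_apply ℝ hd (differentiableAt_const _), fderiv_clm_apply (hDVd x) (differentiableAt_const _)]
    simp
  -- Schwarz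
  have hS : ∀ v w, fderiv ℝ (fderiv ℝ V) x v w = fderiv ℝ (fderiv ℝ V) x w v := fun v w =>
    (hV.contDiffAt.isSymmSndFDerivAt (by simp)).eq v w
  -- `∂ₐ div V = 0`
  have hdiv0 : fderiv ℝ (fun y => ∑ i, ⟪fderiv ℝ V y (b i), b i⟫) x a = 0 := by
    have hfun : (fun y => ∑ i, ⟪fderiv ℝ V y (b i), b i⟫) = fun _ => (0 : ℝ) := by
      funext y
      have h := hdiv y
      rw [divergence_eq_sum_inner_fderiv b V y] at h
      rw [← h]
      exact Finset.sum_congr rfl fun i _ => real_inner_comm _ _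
    rw [hfun]; simp
  have hdiff : ∀ i, DifferentiableAt ℝ (fun y => ⟪fderiv ℝ V y (b i), b i⟫) x := fun i =>
    ((hDVd x).clm_apply (differentiableAt_const _)).inner ℝ (differentiableAt_const _)
  rw [fderiv_fun_sum (fun i _ => hdiff i)] at hdiv0
  simp only [FunLike.coe_sum, Finset.sum_apply, h2'] at hdiv0
  -- the Laplacian of the component
  rw [laplacian_eq_sum_fderiv_fderiv b hη2 x]
  simp_rw [h1, h2, hS]
  exact hdiv0

/-- **Liouville for bounded `C²` fields with symmetric Jacobian and zero divergence**: such a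
field is constant (each component is a bounded harmonic function; KNSS 2009, Lemma 3.1, "bounded
solutions of the system `curl z = 0` and `div z = 0` in `ℝⁿ` are constant by Liouville's
theorem"). [cite: KochNadirashviliSereginSverak2009, Lemma 3.1, proof (arXiv:0709.3599v1 p. 7)] -/
theorem apply_eq_apply_of_symm_fderiv_of_isDivFree_of_bounded {V : E → E} (hV : ContDiff ℝ 2 V)
    (hsymm : ∀ x a c, ⟪fderiv ℝ V x a, c⟫ = ⟪fderiv ℝ V x c, a⟫)
    (hdiv : VectorCalculus.IsDivFree V) {M : ℝ} (hM : ∀ x, ‖V x‖ ≤ M) (x y : E) :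
    V x = V y := by
  refine ext_inner_right ℝ fun a => ?_
  set η : E → ℝ := fun z => ⟪V z, a⟫ with hη
  have hη2 : ContDiff ℝ 2 η := hV.inner ℝ contDiff_const
  have hηΔ : ∀ z, (Δ η) z = 0 := fun z =>
    laplacian_inner_const_eq_zero_of_symm_fderiv_of_isDivFree hV hsymm hdiv a z
  have hharm : HarmonicOnNhd η univ := harmonicOnNhd_of_laplacian_eq_zero hη2 hηΔ
  have hbdd : ∀ z, |η z| ≤ M * ‖a‖ := fun z =>
    (abs_real_inner_le_norm _ _).trans (mul_le_mul_of_nonneg_right (hM z) (norm_nonneg _))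
  exact hharm.apply_eq_apply_of_abs_le hbdd x y

end SymmDiv

/-! ### Fields whose caloric extensions along `rₙ → 0⁺` are constant are a.e. constant -/

section CaloricConstant

/-- **Transposition of the heat flow on scalars**, `L^∞ × L¹`: `∫ χ · e^{rΔ}h = ∫ (e^{rΔ}χ) · h`
for `h` bounded measurable and `χ` integrable (the Gauss–Weierstrass kernel is even; Fubini through
the tree's `integral_convolution_mul_eq`). [folklore] -/
theorem integral_mul_heatExtension_eq_of_top {h χ : E → ℝ} (hh : MemLp h ∞ volume)
    (hχ : Integrable χ) {r : ℝ} (hr : 0 < r) :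
    ∫ x, χ x * UnboundedOperators.heatExtension h r x =
      ∫ x, UnboundedOperators.heatExtension χ r x * h x := by
  have hχ1 : MemLp χ 1 volume := memLp_one_iff_integrable.2 hχ
  set K : E → ℝ := UnboundedOperators.heatKernel (E := E) r with hK
  have hK1 : Integrable K := UnboundedOperators.integrable_heatKernel_holds hr
  have hKeven : ∀ z, K (-z) = (1 : ℝ) * K z := fun z => by
    rw [hK, UnboundedOperators.heatKernel_neg, one_mul]
  have hint : Integrable (fun z : E × E => K (z.1 - z.2) * h z.2 * χ z.1) (volume.prod volume) :=
    UnboundedOperators.integrable_kernel_mul_mul (p := ∞) (q := 1) hK1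
      (memLp_one_iff_integrable.2 hK1) hh hχ1
  have key := UnboundedOperators.integral_convolution_mul_eq hKeven hint
  rw [one_mul] at key
  -- `heatExtension = K ⋆ ·`
  have e1 : ∀ x, χ x * UnboundedOperators.heatExtension h r x =
      (K ⋆[ContinuousLinearMap.lsmul ℝ ℝ, volume] h) x * χ x := fun x => by
    rw [mul_comm]; rfl
  have e2 : ∀ y, UnboundedOperators.heatExtension χ r y * h y =
      h y * (K ⋆[ContinuousLinearMap.lsmul ℝ ℝ, volume] χ) y := fun y => by
    rw [mul_comm]; rfl
  simp_rw [e1, e2]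
  exact key

/-- The components of the caloric extension of a bounded field are the caloric extensions of
its components: `⟪e^{rΔ}f(x), v⟫ = e^{rΔ}⟪f, v⟫(x)`. [folklore] -/
theorem inner_heatExtension_eq_heatExtension_inner_of_bound {f : E → E} (hf : AEStronglyMeasurable f volume)
    {M : ℝ} (hM : ∀ x, ‖f x‖ ≤ M) {r : ℝ} (hr : 0 < r) (v x : E) :
    ⟪UnboundedOperators.heatExtension f r x, v⟫ =
      UnboundedOperators.heatExtension (fun y => ⟪f y, v⟫) r x := by
  rw [UnboundedOperators.heatExtension_apply, UnboundedOperators.heatExtension_apply]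
  have hfm : MemLp (fun y => f (x - y)) ∞ (volume : Measure E) := by
    have h := (memLp_top_of_bound hf M (Eventually.of_forall hM))
    exact h.comp_measurePreserving (Measure.measurePreserving_sub_left volume x)
  have hint : Integrable (fun y => UnboundedOperators.heatKernel r y • f (x - y)) :=
    (UnboundedOperators.integrable_heatKernel_holds hr).smul_of_top_left hfm
  rw [real_inner_comm, ← integral_inner hint v]
  refine integral_congr_ae (Eventually.of_forall fun y => ?_)
  dsimp only
  rw [real_inner_smul_right, real_inner_comm, smul_eq_mul]

/-- **A bounded field whose caloric extensions along a sequence of times `rₙ → 0⁺` are constant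
in space is a.e. constant** (`e^{rₙΔ}f ≡ cₙ` for all `n` ⇒ `f = c₀` a.e.): pairing with a test
function `χ`, `(∫χ) ⟪cₙ, v⟫ = ∫ χ ⟪e^{rₙΔ}f, v⟫ = ∫ (e^{rₙΔ}χ) ⟪f, v⟫ → ∫ χ ⟪f, v⟫` (`e^{rΔ}χ → χ` in
`L¹`, the tree's `tendsto_heatExtension_nhdsWithin_zero_holds`); with `∫χ₀ = 1` the constants
converge, `cₙ → c₀`, whence `∫ χ ⟪f − c₀, v⟫ = 0` for all tests and `f = c₀` a.e. (Mathlib's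
`ae_eq_zero_of_integral_contDiff_smul_eq_zero`). Used for Lemma 3.1 of KNSS 2009 in place of the
compactness argument `ε → 0` of the printed proof. [folklore] -/
theorem exists_ae_eq_const_of_heatExtension_eq_const {f : E → E} (hf : AEStronglyMeasurable f volume)
    {M : ℝ} (hM : ∀ x, ‖f x‖ ≤ M) {r : ℕ → ℝ} (hr : ∀ n, 0 < r n)
    (hr0 : Tendsto r atTop (𝓝 0)) {c : ℕ → E}
    (hc : ∀ n x, UnboundedOperators.heatExtension f (r n) x = c n) :
    ∃ c₀ : E, f =ᵐ[volume] fun _ => c₀ := by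
  set b := stdOrthonormalBasis ℝ E
  have hM0 : 0 ≤ M := (norm_nonneg _).trans (hM 0)
  have hfi : ∀ v, MemLp (fun y => ⟪f y, v⟫) ∞ (volume : Measure E) := fun v =>
    (memLp_top_of_bound hf M (Eventually.of_forall hM)).inner_const v
  have hfib : ∀ v y, ‖⟪f y, v⟫‖ ≤ M * ‖v‖ := fun v y =>
    (norm_inner_le_norm _ _).trans (mul_le_mul_of_nonneg_right (hM y) (norm_nonneg _))
  -- `rₙ → 0⁺`
  have hr0' : Tendsto r atTop (𝓝[>] 0) :=
    tendsto_nhdsWithin_of_tendsto_nhds_of_eventually_within _ hr0 (Eventually.of_forall hr)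
  -- (B) convergence of the pairings with a test function
  have hB : ∀ (χ : E → ℝ), ContDiff ℝ ∞ χ → HasCompactSupport χ → ∀ v : E,
      Tendsto (fun n => (∫ x, χ x) * ⟪c n, v⟫) atTop (𝓝 (∫ x, χ x * ⟪f x, v⟫)) := by
    intro χ hχ hχc v
    have hχi : Integrable χ := hχ.continuous.integrable_of_hasCompactSupport hχc
    have hχ1 : MemLp χ 1 (volume : Measure E) := memLp_one_iff_integrable.2 hχi
    -- rewrite the constants as caloric pairings and transpose
    have h1 : ∀ n, (∫ x, χ x) * ⟪c n, v⟫ = ∫ x, UnboundedOperators.heatExtension χ (r n) x * ⟪f x, v⟫ := by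
      intro n
      rw [← integral_mul_heatExtension_eq_of_top (hfi v) hχi (hr n), ← integral_mul_const]
      refine integral_congr_ae (Eventually.of_forall fun x => ?_)
      dsimp only
      rw [← inner_heatExtension_eq_heatExtension_inner_of_bound hf hM (hr n) v x, hc n x]
    simp_rw [h1]
    -- `L¹` convergence `e^{rΔ}χ → χ` transported to the products
    have hL1 := (UnboundedOperators.tendsto_heatExtension_nhdsWithin_zero_holds (F := ℝ) hχ1 le_rfl
      ENNReal.one_ne_top).comp hr0'
    have i1 : Integrable (fun x => χ x * ⟪f x, v⟫) := hχi.mul_of_top_left (hfi v)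
    refine tendsto_integral_of_L1 (fun x => χ x * ⟪f x, v⟫) i1.aestronglyMeasurable ?_ ?_
    · exact Eventually.of_forall fun n =>
        (UnboundedOperators.integrable_heatExtension hχi (hr n)).mul_of_top_left (hfi v)
    · have hle : ∀ n, (∫⁻ x, ‖UnboundedOperators.heatExtension χ (r n) x * ⟪f x, v⟫ - χ x * ⟪f x, v⟫‖ₑ) ≤
          ENNReal.ofReal (M * ‖v‖) * eLpNorm (UnboundedOperators.heatExtension χ (r n) - χ) 1 volume := by
        intro n
        rw [eLpNorm_one_eq_lintegral_enorm, ← lintegral_const_mul' _ _ ENNReal.ofReal_ne_top]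
        refine lintegral_mono fun x => ?_
        rw [← sub_mul, enorm_mul, Pi.sub_apply, mul_comm]
        gcongr
        rw [← ofReal_norm]
        exact ENNReal.ofReal_le_ofReal (hfib v x)
      refine tendsto_of_tendsto_of_tendsto_of_le_of_le tendsto_const_nhds ?_ (fun _ => bot_le) hle
      have := ENNReal.Tendsto.const_mul (a := ENNReal.ofReal (M * ‖v‖)) hL1
        (Or.inr ENNReal.ofReal_ne_top)
      simpa using this
  -- (C) the constants converge
  obtain ⟨χ₀, hχ₀, hχ₀c, -, hχ₀1⟩ : ∃ χ₀ : E → ℝ, ContDiff ℝ ∞ χ₀ ∧ HasCompactSupport χ₀ ∧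
      (∀ x, 0 ≤ χ₀ x) ∧ ∫ x, χ₀ x = 1 := by
    let B : ContDiffBump (0 : E) := ⟨1, 2, one_pos, one_lt_two⟩
    exact ⟨B.normed volume, B.contDiff_normed, B.hasCompactSupport_normed, fun x => B.nonneg_normed x,
      B.integral_normed⟩
  set κ : E → ℝ := fun v => ∫ x, χ₀ x * ⟪f x, v⟫ with hκ
  have hC : ∀ v, Tendsto (fun n => ⟪c n, v⟫) atTop (𝓝 (κ v)) := by
    intro v
    have h := hB χ₀ hχ₀ hχ₀c v
    simp_rw [hχ₀1, one_mul] at h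
    exact h
  set c₀ : E := ∑ i, κ (b i) • b i with hc₀
  have hC' : Tendsto c atTop (𝓝 c₀) := by
    have hrepr : ∀ n, c n = ∑ i, ⟪c n, b i⟫ • b i := fun n => by
      conv_lhs => rw [← b.sum_repr' (c n)]
      exact Finset.sum_congr rfl fun i _ => by rw [real_inner_comm]
    rw [show c = fun n => ∑ i, ⟪c n, b i⟫ • b i from funext hrepr]
    exact tendsto_finsetSum _ fun i _ => (hC (b i)).smul_const _
  -- (D) `∫ χ ⟪f, v⟫ = (∫ χ) ⟪c₀, v⟫` for every test `χ`
  have hD : ∀ (χ : E → ℝ), ContDiff ℝ ∞ χ → HasCompactSupport χ → ∀ v : E,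
      ∫ x, χ x * ⟪f x, v⟫ = (∫ x, χ x) * ⟪c₀, v⟫ := by
    intro χ hχ hχc v
    have h1 := hB χ hχ hχc v
    have h2 : Tendsto (fun n => (∫ x, χ x) * ⟪c n, v⟫) atTop (𝓝 ((∫ x, χ x) * ⟪c₀, v⟫)) :=
      ((hC'.inner tendsto_const_nhds).const_mul _)
    exact tendsto_nhds_unique h1 h2
  -- (E) the components are a.e. constant
  have hE : ∀ v : E, ∀ᵐ x ∂(volume : Measure E), ⟪f x, v⟫ - ⟪c₀, v⟫ = 0 := by
    intro v
    have hmem : MemLp (fun x => ⟪f x, v⟫ - ⟪c₀, v⟫) ∞ (volume : Measure E) :=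
      (hfi v).sub (memLp_top_const _)
    have hloc : LocallyIntegrable (fun x => ⟪f x, v⟫ - ⟪c₀, v⟫) volume := hmem.locallyIntegrable le_top
    refine ae_eq_zero_of_integral_contDiff_smul_eq_zero hloc fun χ hχ hχc => ?_
    have hχi : Integrable χ := hχ.continuous.integrable_of_hasCompactSupport hχc
    have i1 : Integrable (fun x => χ x * ⟪f x, v⟫) := hχi.mul_of_top_left (hfi v)
    have i2 : Integrable (fun x => χ x * ⟪c₀, v⟫) := hχi.mul_const _
    simp only [smul_eq_mul, mul_sub]
    rw [integral_sub i1 i2, hD χ hχ hχc v, integral_mul_const, sub_self]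
  -- (F) assemble over the frame
  refine ⟨c₀, ?_⟩
  have hall : ∀ᵐ x ∂(volume : Measure E), ∀ i, ⟪f x, b i⟫ - ⟪c₀, b i⟫ = 0 :=
    ae_all_iff.2 fun i => hE (b i)
  filter_upwards [hall] with x hx
  have hf' : f x = ∑ i, ⟪f x, b i⟫ • b i := by
    conv_lhs => rw [← b.sum_repr' (f x)]
    exact Finset.sum_congr rfl fun i _ => by rw [real_inner_comm]
  have hc' : c₀ = ∑ i, ⟪c₀, b i⟫ • b i := by
    conv_lhs => rw [← b.sum_repr' c₀]
    exact Finset.sum_congr rfl fun i _ => by rw [real_inner_comm]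
  rw [hf', hc']
  exact Finset.sum_congr rfl fun i _ => by rw [sub_eq_zero.1 (hx i)]

end CaloricConstant

end Literature.Analysis.FluidPDE
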